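import Mathlib
import HarnessLib
import Summits.HubbardSuperconductivity.HubbardSuperconductivity.Theorems.KLProgrammeKLRegimeEngineScaleZeroE1Sizes
import Summits.HubbardSuperconductivity.HubbardSuperconductivity.Theorems.KLProgrammeKLRegimeEngineScaleZeroE1Algebra

/-!
# K3 engine child (stmt-HubbardSuperconductivity-19855), stub `stub_engine_scale0`, clause (E1-v4)₀: the ORDER-BY-ORDER bound
# `‖W^{(0),a}_{2p}‖ ≤ 2^p·4e⁹κ₀⁴·(C_T²/κ₀²)^p·(16e⁹κ₀²A₀|U|)^{p-2}·|U|` on every admissible frame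

Cell gate-hubbard-kl, seat hubbard-kl-k3c2-p1.  Combination of `klAnisoLegKernelNorm_zero_le_explicit` (symbol layer discharged),
`scaleZero_T_le` (the `β/L/M` cancellation in the overlap size) and `scaleZero_order_algebra_le` (the per-order algebra): given the
covariance size `A₀ = α·β/(4M)` (k3c4-p2's `alpha_scaleZero_le`), the counterterm profile entry `kK` and the smallness `θ ≤ 1/2`,
the scale-`0` anisotropic `2p`-leg kernel norm is bounded by `p - 1` powers of `|U|` times frame-independent constants — the form
`CE^p (Klam·U)^{p-1}` of `KernelNormsV4 … 0` up to the choice of `CE` (Q4, by name).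

* **`klAnisoLegKernelNorm_zero_le_order`**.

Everything is proved; no definitions, no named facts, no sorry.
-/

noncomputable section

namespace Summit.HubbardSuperconductivity.HubbardSuperconductivity.Theorems.EngineV8

set_option linter.dupNamespace false -- summit = problem name (single-conjunct summit), D-0017

open Real Finset Literature.MathematicalPhysics.QuantumLattice Literature.Probability.LatticeModels
open Summit.HubbardSuperconductivity.HubbardSuperconductivity.Theorems.KLRegimeSplit
open Summit.HubbardSuperconductivity.HubbardSuperconductivity.Theorems.KLProgrammeLegKernels

variable {L M : ℕ} [NeZero L]

/-- **(E1-v4)₀ order by order**: for an admissible frame in the regime (`FrameOK`, `Gfr ≥ 0`, `μ ∈ klWindowC`, `(16/15)Gfr0|U| ≤ 1/50`,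
`2^15 ≤ L`, `klBetaMin ≤ β ≤ L`, `β ≤ M`, `2 ≤ M`, `klE0·β ≤ π(2M-3)`), a covariance size `A₀ > 0` (`Σ ‖(SᵀC S)(X,·)‖, Σ ‖(SᵀC S)(·,Y)‖ ≤ 4M·A₀/β`),
a profile entry `kK ≥ Σ_z ‖Ǩ_L(z)‖` and `θ ≤ 1/2`:
`klAnisoLegKernelNorm … klE0 0 (2p) ≤ 2^p·4e⁹κ₀⁴·(C_T²/κ₀²)^p·(16e⁹κ₀²A₀|U|)^{p-2}·|U|`, `κ₀ = √(2·6054)`,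
`C_T = √(2048(16π/e₀+1)Φ(s₁))·√(64·1794e₀(e₀/π + 1/klBetaMin))`, `Φ(s) = 4(2√2/s+2)² + 16(1/s+1)²`, `s₁ = 2/(π(C_s⋆+1))`. -/
theorem klAnisoLegKernelNorm_zero_le_order [NeZero M] {R : RenConsts} {U : ℝ} {N : ℕ} {μ : ℝ} {K : TrigPolyC4v}
    (hK : FrameOK R U N μ K) (hR : ∀ j, 0 ≤ R.Gfr j) (hμ : μ ∈ klWindowC) (hκU : 16 / 15 * (R.Gfr 0 * |U|) ≤ 1 / 50)
    (hL : (2 : ℝ) ^ 15 ≤ L) {β : ℝ} (hβ : klBetaMin ≤ β) (hβL : β ≤ L) (hβM : β ≤ M) (hM2 : 2 ≤ M)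
    (hMβ : klE0 * β ≤ Real.pi * (2 * M - 3)) {kK : ℝ}
    (hkK : ∑ z : TorusSite 2 L, ‖framePosKernel L K z‖ ≤ kK)
    {A₀ : ℝ} (hA₀ : 0 < A₀)
    (hrow : ∀ X, ∑ Y, ‖((hubbardGridSub L M β (2 * (2 * M))).transpose * hubbardCovAboveCT L M β μ 0 K klE0 *
      hubbardGridSub L M β (2 * (2 * M))) X Y‖ ≤ 4 * M * A₀ / β)
    (hcol : ∀ Y, ∑ X, ‖((hubbardGridSub L M β (2 * (2 * M))).transpose * hubbardCovAboveCT L M β μ 0 K klE0 *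
      hubbardGridSub L M β (2 * (2 * M))) X Y‖ ≤ 4 * M * A₀ / β)
    (hθ : Real.exp 1 * (4 * M * A₀ / β) *
        normV (GridLeg (GridPoint L (2 * (2 * M)))) (Real.sqrt (2 * (7 + 6047))) (Real.sqrt (2 * (7 + 6047)))
          ((fun m' : ℕ => if m' = 1 then |β| / (2 * (2 * M) : ℕ) * kK else if m' = 2 then |U| * |β| / (2 * (2 * M) : ℕ) else 0)) /
        Real.sqrt (2 * (7 + 6047)) ^ 2 ≤ 1 / 2)
    {p : ℕ} (hp : 2 ≤ p) :
    klAnisoLegKernelNorm L M β U μ K klE0 0 (2 * p) ≤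
      2 ^ p * (4 * Real.exp 1 ^ 9 * Real.sqrt (2 * (7 + 6047)) ^ 4) *
        ((Real.sqrt (2048 * (16 * Real.pi / klE0 + 1) *
            (4 * ((2 * Real.sqrt 2 / (2 / (Real.pi * ((22484224 / 9 + 7180 / 3 * sectorCircLineConst) + 1))) + 2) *
              (2 * Real.sqrt 2 / (2 / (Real.pi * ((22484224 / 9 + 7180 / 3 * sectorCircLineConst) + 1))) + 2)) +
              16 * (1 / (2 / (Real.pi * ((22484224 / 9 + 7180 / 3 * sectorCircLineConst) + 1))) + 1) ^ 2)) *
          Real.sqrt (64 * (1794 * klE0) * (klE0 / Real.pi + 1 / klBetaMin))) ^ 2 / Real.sqrt (2 * (7 + 6047)) ^ 2) ^ p *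
        (16 * Real.exp 1 ^ 9 * Real.sqrt (2 * (7 + 6047)) ^ 2 * A₀ * |U|) ^ (p - 2) * |U| := by
  have he : (0 : ℝ) < klE0 := by norm_num [klE0]
  have hβpos : 0 < β := lt_of_lt_of_le (by norm_num [klBetaMin]) hβ
  have hM2' : (2 : ℝ) ≤ M := by exact_mod_cast hM2
  have hMpos : (0 : ℝ) < M := by linarith
  have hLpos : (0 : ℝ) < L := lt_of_lt_of_le (by norm_num) hL
  have hκ₀ : 0 < Real.sqrt (2 * (7 + 6047)) := Real.sqrt_pos.2 (by norm_num)
  have hπ := Real.pi_pos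
  have hB := sectorCircLineConst_nonneg
  have hα : 0 < 4 * M * A₀ / β := by positivity
  have hθ1 : Real.exp 1 * (4 * M * A₀ / β) *
        normV (GridLeg (GridPoint L (2 * (2 * M)))) (Real.sqrt (2 * (7 + 6047))) (Real.sqrt (2 * (7 + 6047)))
          ((fun m' : ℕ => if m' = 1 then |β| / (2 * (2 * M) : ℕ) * kK else if m' = 2 then |U| * |β| / (2 * (2 * M) : ℕ) else 0)) /
        Real.sqrt (2 * (7 + 6047)) ^ 2 < 1 := lt_of_le_of_lt hθ (by norm_num)
  -- the explicit bound
  have h := klAnisoLegKernelNorm_zero_le_explicit hK hR hμ hκU hL hβ hβL hM2 hMβ hkK hα hrow hcol hθ1 hp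
  -- the size `T`
  set Φ : ℝ := 4 * ((2 * Real.sqrt 2 / (2 / (Real.pi * ((22484224 / 9 + 7180 / 3 * sectorCircLineConst) + 1))) + 2) *
      (2 * Real.sqrt 2 / (2 / (Real.pi * ((22484224 / 9 + 7180 / 3 * sectorCircLineConst) + 1))) + 2)) +
      16 * (1 / (2 / (Real.pi * ((22484224 / 9 + 7180 / 3 * sectorCircLineConst) + 1))) + 1) ^ 2 with hΦ
  have hΦ0 : 0 ≤ Φ := by rw [hΦ]; positivity
  set Ns : ℕ := (((univ : Finset (TorusSite 1 (2 * (2 * M)))).filter fun q₁ => |gridFreq M (2 * (2 * M)) β q₁| < klE0) ×ˢ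
      ((univ : Finset (TorusSite 2 L)).filter fun k => |nambuXiCT L μ K k| < klE0)).card with hNs
  have hNsle : ((Ns : ℕ) : ℝ) ≤ (klE0 * β / Real.pi + 1) * (1793 * klE0 * (L : ℝ) ^ 2 + 704 * L) := by
    rw [hNs]; exact card_freqWindow_mul_shell_le_of_frameOK hK hβpos
  set T : ℝ := 1 / (|β| * (L : ℝ) ^ 2) *
      (Real.sqrt (2048 * (1 / (β * klE0 / (16 * Real.pi * M)) + 1) * Φ) *
        Real.sqrt (16 * (2 * (2 * M) : ℕ) * (L : ℝ) ^ 2 * ((Ns : ℕ) : ℝ))) with hT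
  have hT0 : 0 ≤ T := by rw [hT]; positivity
  set CT : ℝ := Real.sqrt (2048 * (16 * Real.pi / klE0 + 1) * Φ) *
      Real.sqrt (64 * (1794 * klE0) * (klE0 / Real.pi + 1 / klBetaMin)) with hCT
  have hTle : T ≤ CT * M / β := by
    have h1 := scaleZero_T_le (L := L) (M := M) hβ hβM hL hΦ0 (Nat.cast_nonneg Ns) hNsle
    rw [hT, hCT]
    exact h1.trans_eq (by ring)
  -- the θ-denominator as an atom
  set θv : ℝ := Real.exp 1 * (4 * M * A₀ / β) *
      normV (GridLeg (GridPoint L (2 * (2 * M)))) (Real.sqrt (2 * (7 + 6047))) (Real.sqrt (2 * (7 + 6047)))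
        ((fun m' : ℕ => if m' = 1 then |β| / (2 * (2 * M) : ℕ) * kK else if m' = 2 then |U| * |β| / (2 * (2 * M) : ℕ) else 0)) /
      Real.sqrt (2 * (7 + 6047)) ^ 2 with hθv
  -- the per-order algebra
  have halg := scaleZero_order_algebra_le (U := U) (θ := θv) hp hβpos hMpos hκ₀ hT0 hTle hA₀.le hθ
  -- bridge the two syntactic forms
  have hcast : ((2 * (2 * M) : ℕ) : ℝ) = 4 * M := by push_cast; ring
  refine h.trans (le_of_eq_of_le ?_ halg)
  simp only [imagTimeWeight, hcast, abs_of_pos hβpos, hT, hΦ, hNs]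

end Summit.HubbardSuperconductivity.HubbardSuperconductivity.Theorems.EngineV8

end
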